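import Mathlib
import Literature.Analysis.FluidPDE.ClassicalSolution
import Literature.Analysis.FluidPDE.LerayHopf
import Literature.Analysis.FluidPDE.NSWave0
import Literature.Analysis.FluidPDE.SuitableWeak
import Summits.NavierStokesRegularity.NavierStokesRegularity.Theses.L3TimeExponentPincer
import Summits.NavierStokesRegularity.NavierStokesRegularity.Theorems.L3TimeExponentPincerJawSuperEuler
import Summits.NavierStokesRegularity.NavierStokesRegularity.Theorems.L3TimeExponentPincerJawEulerBox
import HarnessLib

/-!
# What the residual crux `SupercriticalSerrinL3` says about blow-ups, in Euler-box language
# (route `L3TimeExponentPincer`, items stmt-NavierStokesRegularity-19500 / -19499)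

Support file (cell ns-regularity-ideate, seat ns-pincer-19499-p1 g2), fourth after the localisation triple
`L3TimeExponentPincerJawSuperEuler` (p471620), `…JawSubEulerEddy` (p473776), `…JawEulerBox` (p475049).
The route is `(A) ⟺ L3CascadeJaw ∧ SupercriticalSerrinL3` (p455741); the triple localised the ATTACKED conjunct to
the Euler box.  Here the same dictionary is applied to the RESIDUAL conjunct `SupercriticalSerrinL3` ("some
`p ∈ (4,5)`: `L^p_t L³_x` near `T` ⇒ smooth extension"), all by name and unconditional AS IMPLICATIONS:

* `supEulerLaw_of_isTypeIBlowup` — a Type-I field (`|u| ≤ C/√(T-t)` near `T`) obeys the sup Euler-speed law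
  `|u| ≤ K (T-t)^{-3/5}` near `T` (`1/2 < 3/5`): the Euler-speed class CONTAINS the Type-I class;
* `hasSmoothExtensionPast_of_supEulerSpeedLaw_of_supercriticalSerrinL3` — under the residual, every frame solution
  obeying the sup Euler-speed law near `T` extends smoothly past `T`; equivalently
  `exists_superEulerSpeed_of_blowup_of_supercriticalSerrinL3` — **under the residual every frame blow-up is
  super-Euler-fast arbitrarily close to `T`**: for all `K, T₁ < T` there are `t ∈ (T₁,T)` and `x` with
  `|u(t,x)| > K (T-t)^{-3/5}`.  So the residual contains not only Type-I exclusion (`noTypeIBlowup_of_…`, p4,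
  rate `1/2`) but the exclusion of every blow-up of sup-rate `≤ 3/5` ("mildly Type-II" blow-ups included);
* `exists_l3Fast_of_blowup_of_supercriticalSerrinL3` — under the residual every frame blow-up is `L³`-super-Euler
  arbitrarily close to `T`: `‖u(t)‖₃ > M (T-t)^{-1/5}` at times `t → T` for every `M`
  (`limsup_{t→T} (T-t)^{1/5}‖u(t)‖₃ = ∞`; via the time localisation `jawClauseAt_iff_fastTimes`), and the fast
  times even carry a divergent `∫ ‖u‖₃^p` (`fastTimes_eq_top_of_blowup_of_supercriticalSerrinL3`);
* `eulerBox_eq_top_of_blowup_of_supercriticalSerrinL3` — under the residual every frame blow-up carries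
  NON-integrable Euler-box mass: `∫_{T₂}^T (∫_{|w|>K₂(T-t)^{-3/5}} |w|³)^{p/3} dt = ∞` on every final window, `w`
  the sub-eddy fluctuation `u - A_{K₁(T-t)^{2/5}} u` (via `jawClauseAt_iff_eulerBox`).

Reading for the route: mirror-symmetric to `exists_superEuler_blowup_of_not_l3CascadeJaw` (p453065: `¬jaw` ⇒ SOME
blow-up has super-Euler `L³` bursts), the residual says ALL blow-ups do — the pincer meets exactly on the Euler box.

WHAT THIS IS NOT: not a claim about Navier–Stokes regularity or blow-up; implications from the open residual
crux, landed `--supports`; no item is closed.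
-/

noncomputable section

namespace Summit.NavierStokesRegularity.NavierStokesRegularity.Theorems.L3TimeExponentPincerSerrinEulerBridge

open MeasureTheory Set Function Filter Metric Topology
open scoped ENNReal NNReal
open Literature.Analysis.FluidPDE
open Summit.NavierStokesRegularity.NavierStokesRegularity.Theses.L3TimeExponentPincer
  (L3CascadeJaw SupercriticalSerrinL3)
open Summit.NavierStokesRegularity.NavierStokesRegularity.Theorems.L3TimeExponentPincerJawSuperEuler
  (jawClauseAt_of_supEulerSpeedLaw)
open Summit.NavierStokesRegularity.NavierStokesRegularity.Theorems.L3TimeExponentPincerJawEulerBox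
  (jawClauseAt_iff_fastTimes jawClauseAt_iff_eulerBox)

/-! ## §1  The Euler-speed class contains the Type-I class -/

/-- A Type-I field near `T` (`|u(t,x)| ≤ C/√(T-t)`) obeys the sup Euler-speed law `|u(t,x)| ≤ K (T-t)^{-3/5}` on a
final window (`K = max C 0`; for `0 < T - t ≤ 1`, `(T-t)^{-1/2} ≤ (T-t)^{-3/5}`). [folklore] -/
theorem supEulerLaw_of_isTypeIBlowup {u : ℝ → EuclideanSpace ℝ (Fin 3) → EuclideanSpace ℝ (Fin 3)} {T : ℝ}
    (h : IsTypeIBlowup u T) :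
    ∃ K : ℝ, 0 ≤ K ∧ ∃ T₁ < T, ∀ t ∈ Ioo T₁ T, ∀ x, ‖u t x‖ ≤ K * (T - t) ^ (-(3 / 5 : ℝ)) := by
  obtain ⟨C, hev⟩ := h
  obtain ⟨l, hlT, hl⟩ := (mem_nhdsLT_iff_exists_Ioo_subset).1 hev
  refine ⟨max C 0, le_max_right _ _, max l (T - 1), max_lt hlT (by linarith), fun t ht x => ?_⟩
  have hs : 0 < T - t := sub_pos.2 ht.2
  have hs1 : T - t ≤ 1 := by linarith [(le_max_right l (T - 1)).trans_lt ht.1]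
  have hb : ‖u t x‖ ≤ C / Real.sqrt (T - t) := hl ⟨(le_max_left _ _).trans_lt ht.1, ht.2⟩ x
  have hsqrt : 0 < Real.sqrt (T - t) := Real.sqrt_pos.2 hs
  calc ‖u t x‖ ≤ C / Real.sqrt (T - t) := hb
    _ ≤ max C 0 / Real.sqrt (T - t) := div_le_div_of_nonneg_right (le_max_left C 0) hsqrt.le
    _ = max C 0 * (T - t) ^ (-(1 / 2 : ℝ)) := by
        rw [Real.sqrt_eq_rpow, Real.rpow_neg hs.le, div_eq_mul_inv]
    _ ≤ max C 0 * (T - t) ^ (-(3 / 5 : ℝ)) :=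
        mul_le_mul_of_nonneg_left (Real.rpow_le_rpow_of_exponent_ge hs hs1 (by norm_num)) (le_max_right _ _)

/-! ## §2  Under the residual, no blow-up obeys the sup Euler-speed law -/

/-- **Residual ⇒ the sup Euler-speed law forces smooth extension.**  Under `SupercriticalSerrinL3`, a frame solution
with `|u(t,x)| ≤ K (T-t)^{-3/5}` on a final window extends smoothly past `T`: the sup law gives the clause at the
residual's exponent `p < 5` (`jawClauseAt_of_supEulerSpeedLaw`), and the residual returns the extension. -/
theorem hasSmoothExtensionPast_of_supEulerSpeedLaw_of_supercriticalSerrinL3 (h : SupercriticalSerrinL3)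
    {ν T : ℝ} (hν : 0 < ν) (hT : 0 < T)
    {u : ℝ → EuclideanSpace ℝ (Fin 3) → EuclideanSpace ℝ (Fin 3)} {p : ℝ → EuclideanSpace ℝ (Fin 3) → ℝ}
    (hcl : IsClassicalNSSolutionOn (Ico 0 T) ν 0 u p) (hLH : IsLerayHopfOn T ν 0 (u 0) u)
    (hdec : HasRapidSpatialDecay (u 0))
    {K T₁ : ℝ} (hK : 0 ≤ K) (hT₁ : T₁ < T)
    (hsup : ∀ t ∈ Ioo T₁ T, ∀ x, ‖u t x‖ ≤ K * (T - t) ^ (-(3 / 5 : ℝ))) :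
    HasSmoothExtensionPast ν 0 u T := by
  obtain ⟨q, hq4, hq5, hS⟩ := h
  exact hS ν T hν hT u p hcl hLH hdec (jawClauseAt_of_supEulerSpeedLaw hν hT hcl hLH hK hT₁ hsup (by linarith) hq5)

/-- **Residual ⇒ every blow-up is super-Euler-fast arbitrarily close to `T`.**  Under `SupercriticalSerrinL3`, a
frame solution with NO smooth extension past `T` violates every sup Euler-speed envelope at times arbitrarily close
to `T`: for all `K ≥ 0` and `T₁ < T` there are `t ∈ (T₁,T)` and `x` with `|u(t,x)| > K (T-t)^{-3/5}`.  (The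
residual thus excludes all blow-ups of sup-rate `≤ 3/5`, strictly more than Type-I exclusion, rate `1/2`.) -/
theorem exists_superEulerSpeed_of_blowup_of_supercriticalSerrinL3 (h : SupercriticalSerrinL3)
    {ν T : ℝ} (hν : 0 < ν) (hT : 0 < T)
    {u : ℝ → EuclideanSpace ℝ (Fin 3) → EuclideanSpace ℝ (Fin 3)} {p : ℝ → EuclideanSpace ℝ (Fin 3) → ℝ}
    (hcl : IsClassicalNSSolutionOn (Ico 0 T) ν 0 u p) (hLH : IsLerayHopfOn T ν 0 (u 0) u)
    (hdec : HasRapidSpatialDecay (u 0)) (hblow : ¬ HasSmoothExtensionPast ν 0 u T)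
    {K : ℝ} (hK : 0 ≤ K) {T₁ : ℝ} (hT₁ : T₁ < T) :
    ∃ t ∈ Ioo T₁ T, ∃ x, K * (T - t) ^ (-(3 / 5 : ℝ)) < ‖u t x‖ := by
  by_contra hcon
  push Not at hcon
  exact hblow (hasSmoothExtensionPast_of_supEulerSpeedLaw_of_supercriticalSerrinL3 h hν hT hcl hLH hdec hK hT₁ hcon)

/-! ## §3  Under the residual, every blow-up is `L³`-super-Euler and carries divergent Euler-box mass -/

/-- **Residual ⇒ the fast times of a blow-up carry a divergent `∫‖u‖₃^p`.**  Under `SupercriticalSerrinL3` (exponent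
`p`), for every frame blow-up, every `M ≥ 0` and every final window `(T₂,T)`:
`∫_{(T₂,T) ∩ {‖u(t)‖₃ > M(T-t)^{-1/5}}} ‖u(t)‖₃^p dt = ∞`. -/
theorem fastTimes_eq_top_of_blowup_of_supercriticalSerrinL3 (h : SupercriticalSerrinL3) :
    ∃ q : ℝ, 4 < q ∧ q < 5 ∧ ∀ (ν T : ℝ), 0 < ν → 0 < T →
      ∀ (u : ℝ → EuclideanSpace ℝ (Fin 3) → EuclideanSpace ℝ (Fin 3)) (p : ℝ → EuclideanSpace ℝ (Fin 3) → ℝ),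
        IsClassicalNSSolutionOn (Ico 0 T) ν 0 u p → IsLerayHopfOn T ν 0 (u 0) u →
        HasRapidSpatialDecay (u 0) → ¬ HasSmoothExtensionPast ν 0 u T →
        ∀ M : ℝ, 0 ≤ M → ∀ T₂ ∈ Ioo 0 T,
          (∫⁻ t in Ioo T₂ T ∩ {s | ENNReal.ofReal (M * (T - s) ^ (-(1 / 5 : ℝ))) < eLpNorm (u s) 3 volume},
            eLpNorm (u t) 3 volume ^ q) = ⊤ := by
  obtain ⟨q, hq4, hq5, hS⟩ := h
  refine ⟨q, hq4, hq5, fun ν T hν hT u p hcl hLH hdec hblow M hM T₂ hT₂ => ?_⟩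
  by_contra hne
  have hfin : (∫⁻ t in Ioo T₂ T ∩ {s | ENNReal.ofReal (M * (T - s) ^ (-(1 / 5 : ℝ))) < eLpNorm (u s) 3 volume},
      eLpNorm (u t) 3 volume ^ q) < ⊤ := lt_top_iff_ne_top.2 hne
  have hclause := (jawClauseAt_iff_fastTimes (T := T) u hM (by linarith) hq5).2 ⟨T₂, hT₂, hfin⟩
  exact hblow (hS ν T hν hT u p hcl hLH hdec hclause)

/-- **Residual ⇒ every blow-up is `L³`-super-Euler arbitrarily close to `T`**: under `SupercriticalSerrinL3`, a frame
blow-up has, for every `M ≥ 0` and `T₁ < T`, a time `t ∈ (T₁,T)` with `‖u(t)‖₃ > M (T-t)^{-1/5}`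
(`limsup_{t→T} (T-t)^{1/5}‖u(t)‖₃ = ∞`). -/
theorem exists_l3Fast_of_blowup_of_supercriticalSerrinL3 (h : SupercriticalSerrinL3)
    {ν T : ℝ} (hν : 0 < ν) (hT : 0 < T)
    {u : ℝ → EuclideanSpace ℝ (Fin 3) → EuclideanSpace ℝ (Fin 3)} {p : ℝ → EuclideanSpace ℝ (Fin 3) → ℝ}
    (hcl : IsClassicalNSSolutionOn (Ico 0 T) ν 0 u p) (hLH : IsLerayHopfOn T ν 0 (u 0) u)
    (hdec : HasRapidSpatialDecay (u 0)) (hblow : ¬ HasSmoothExtensionPast ν 0 u T)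
    {M : ℝ} (hM : 0 ≤ M) {T₁ : ℝ} (hT₁ : T₁ < T) :
    ∃ t ∈ Ioo T₁ T, ENNReal.ofReal (M * (T - t) ^ (-(1 / 5 : ℝ))) < eLpNorm (u t) 3 volume := by
  obtain ⟨q, -, -, hq⟩ := fastTimes_eq_top_of_blowup_of_supercriticalSerrinL3 h
  set T₂ : ℝ := max T₁ (T / 2) with hT₂
  have hT₂mem : T₂ ∈ Ioo 0 T := ⟨lt_max_of_lt_right (by linarith), max_lt hT₁ (by linarith)⟩
  have htop := hq ν T hν hT u p hcl hLH hdec hblow M hM T₂ hT₂mem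
  by_contra hcon
  push Not at hcon
  have hempty : Ioo T₂ T ∩ {s | ENNReal.ofReal (M * (T - s) ^ (-(1 / 5 : ℝ))) < eLpNorm (u s) 3 volume} = ∅ := by
    refine Set.eq_empty_of_forall_notMem fun s hs => ?_
    exact (not_lt.2 (hcon s ⟨(le_max_left _ _).trans_lt hs.1.1, hs.1.2⟩)) hs.2
  rw [hempty, Measure.restrict_empty, lintegral_zero_measure] at htop
  exact ENNReal.zero_ne_top htop

/-- **Residual ⇒ every blow-up carries non-integrable Euler-box mass.**  Under `SupercriticalSerrinL3` (exponent `p`),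
for every frame blow-up, all `K₁ > 0`, `K₂ ≥ 0` and every final window `(T₂,T)`: with the sub-eddy fluctuation
`w(t) = u(t) - A_{K₁(T-t)^{2/5}} u(t)`, `∫_{T₂}^T (∫_{|w(t)|>K₂(T-t)^{-3/5}} |w(t)|³)^{p/3} dt = ∞`. -/
theorem eulerBox_eq_top_of_blowup_of_supercriticalSerrinL3 (h : SupercriticalSerrinL3) :
    ∃ q : ℝ, 4 < q ∧ q < 5 ∧ ∀ (ν T : ℝ), 0 < ν → 0 < T →
      ∀ (u : ℝ → EuclideanSpace ℝ (Fin 3) → EuclideanSpace ℝ (Fin 3)) (p : ℝ → EuclideanSpace ℝ (Fin 3) → ℝ),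
        IsClassicalNSSolutionOn (Ico 0 T) ν 0 u p → IsLerayHopfOn T ν 0 (u 0) u →
        HasRapidSpatialDecay (u 0) → ¬ HasSmoothExtensionPast ν 0 u T →
        ∀ K₁ : ℝ, 0 < K₁ → ∀ K₂ : ℝ, 0 ≤ K₂ → ∀ T₂ ∈ Ioo 0 T,
          (∫⁻ t in Ioo T₂ T,
            (∫⁻ x in {y | K₂ * (T - t) ^ (-(3 / 5 : ℝ)) <
                ‖u t y - (volume (closedBall (0 : EuclideanSpace ℝ (Fin 3)) (K₁ * (T - t) ^ (2 / 5 : ℝ)))).toReal⁻¹ •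
                  ∫ z in closedBall (0 : EuclideanSpace ℝ (Fin 3)) (K₁ * (T - t) ^ (2 / 5 : ℝ)), u t (y + z)‖},
              ‖u t x - (volume (closedBall (0 : EuclideanSpace ℝ (Fin 3)) (K₁ * (T - t) ^ (2 / 5 : ℝ)))).toReal⁻¹ •
                  ∫ z in closedBall (0 : EuclideanSpace ℝ (Fin 3)) (K₁ * (T - t) ^ (2 / 5 : ℝ)), u t (x + z)‖ₑ ^ 3) ^
              (q / 3)) = ⊤ := by
  obtain ⟨q, hq4, hq5, hS⟩ := h
  refine ⟨q, hq4, hq5, fun ν T hν hT u p hcl hLH hdec hblow K₁ hK₁ K₂ hK₂ T₂ hT₂ => ?_⟩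
  by_contra hne
  have hfin := lt_top_iff_ne_top.2 hne
  have hclause := (jawClauseAt_iff_eulerBox hν hcl hLH hK₁ (le_refl (2 / 5 : ℝ)) hK₂ (le_refl (3 / 5 : ℝ))
    (by linarith) hq5).2 ⟨T₂, hT₂, hfin⟩
  exact hblow (hS ν T hν hT u p hcl hLH hdec hclause)

end Summit.NavierStokesRegularity.NavierStokesRegularity.Theorems.L3TimeExponentPincerSerrinEulerBridge

end
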